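import Summits.Schanuel.Schanuel.Theorems.ZilberEacTorusRuled
import HarnessLib

/-!
# Torus-ruled varieties meet the graph of `exp`, II: the periodic half of `EC(3,2)`

Zilber's Exponential-Algebraic Closedness, case ladder (host summit Schanuel, cell `pub-schanuel`,
seat 2, gen 4).  Continuation of `ZilberEacTorusRuled.lean` (Theorems A, B there): the PERIODIC
sub-cell of the first open rung `EC(3,2)` for torus-ruled varieties.

* `infinite_image_linForm_of_isAddFree`: on an additively free irreducible `V` every nonzero
  integer linear form takes infinitely many values.
* `hasDominantAddProjection_of_isPeriodVec_of_isPeriodVec_last` (`n = 3`): two ℤ-independent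
  period vectors of the base of an additively free `V` force a DOMINANT additive projection.
* **Theorem C** (`inter_expGraph_nonempty_of_isTorusStable_of_isPeriodVec_last`): normalised
  periodic half (base period `e_last`), ruling direction `ν ∦ e_last` ⇒ `W ∩ Γ_exp ≠ ∅`;
  **Theorem C′** (`…_of_indep_period`): coordinate-free form — base period `v`, ruling direction
  ℤ-independent of `v` ⇒ `W ∩ Γ_exp ≠ ∅` (no rotundity, no multiplicative freeness used).
* **Reduction** (`inter_expGraph_nonempty_of_isTorusStable_three_two`): granted the single residual
  piece "base period `e_last` and `W` a cylinder in `y_last`" (which contains Mantova–Masser's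
  density question for exponential points of `(2,1)`-surfaces over curve bases), EVERY torus-ruled
  member of the cell `EC(3,2)` meets `Γ_exp`.

Honest framing: a modest structural sub-case of one open cell of Zilber's EAC conjecture;
`ECCell 3 2` stays OPEN; nothing here bears on Schanuel's conjecture, and EAC does not imply SC.

References: Aslanyan–Kirby–Mantova, IMRN 2023, Thm. 1.5 (tree theorem
`aslanyanKirbyMantova2023_thm_1_5_holds`); Mantova–Masser, PLMS 129 (2024) §1.
-/

noncomputable section

open MvPolynomial Matrix
open Literature.NumberTheory.Transcendental Literature.ModelTheory.Zilber

set_option linter.dupNamespace false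

namespace Summit.Schanuel.Schanuel.Theorems

variable {n : ℕ}

/-! ## Theorem C: the normalised periodic half of `EC(3,2)` -/

/-- If `V = W ∩ Gⁿ` (`W` irreducible, `V ≠ ∅`) is additively free then every nonzero integer linear
form `∑ mᵢ xᵢ` takes infinitely many values on `V` (finitely many values `c₁, …, c_k` would put
`∏ₖ (∑ mᵢ Xᵢ - c_k)` in the prime `I(V)`). [folklore] -/
theorem infinite_image_linForm_of_isAddFree {K : Type*} [Field K] {W : Set (Fin n ⊕ Fin n → K)}
    (hW : IsIrreducibleClosed K W) (hne : (W ∩ torusLocus K n).Nonempty)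
    (hadd : IsAddFree K n (W ∩ torusLocus K n)) {m : Fin n → ℤ} (hm : m ≠ 0) :
    ((fun z => ∑ i, (m i : K) * z (Sum.inl i)) '' (W ∩ torusLocus K n)).Infinite := by
  intro hfin
  set s := hfin.toFinset with hs
  haveI hprime := vanishingIdeal_inter_torusLocus_isPrime_of_irred hW hne
  set ℓ : MvPolynomial (Fin n ⊕ Fin n) K := ∑ i, C (m i : K) * X (Sum.inl i) with hℓ
  have hℓev : ∀ z : Fin n ⊕ Fin n → K, aeval z ℓ = ∑ i, (m i : K) * z (Sum.inl i) := by
    intro z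
    simp [hℓ, map_sum]
  have hmem : (∏ c ∈ s, (ℓ - C c)) ∈ vanishingIdeal K (W ∩ torusLocus K n) := by
    rw [mem_vanishingIdeal_iff]
    intro z hz
    rw [map_prod]
    refine Finset.prod_eq_zero (i := ∑ i, (m i : K) * z (Sum.inl i)) ?_ ?_
    · rw [hs, Set.Finite.mem_toFinset]
      exact ⟨z, hz, rfl⟩
    · rw [map_sub, hℓev, aeval_C, Algebra.algebraMap_self_apply, sub_self]
  obtain ⟨c, -, hc⟩ := Ideal.IsPrime.prod_mem_iff.mp hmem
  refine hadd m hm ⟨c, fun z hz => ?_⟩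
  have := (mem_vanishingIdeal_iff.1 hc) z hz
  rwa [map_sub, hℓev, aeval_C, Algebra.algebraMap_self_apply, sub_eq_zero] at this

/-- **Two independent periods force a dominant additive projection (`n = 3`).**  In the normalised
periodic sub-cell of `EC(3,2)` (irreducible `W`, additively free `V = W ∩ G³`, base period
`e_last`), if some `ν` with `(ν₀, ν₁) ≠ 0` is ALSO a period vector of the base, then `π(V)` is
Zariski dense in `ℂ³`: the closure `B` of `π(V)` contains with each point the plane spanned by `ν`
and `e_last`, i.e. `B ⊇ {ℓ = a}` for every value `a` of the integer linear form
`ℓ = ν₁x₀ - ν₀x₁` on `V` — infinitely many values by additive freeness — so a polynomial vanishing on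
`B` vanishes on every line `x + ℂ·(ν₁, -ν₀, 0)`, hence everywhere. [folklore] -/
theorem hasDominantAddProjection_of_isPeriodVec_of_isPeriodVec_last
    {W : Set (Fin (2 + 1) ⊕ Fin (2 + 1) → ℂ)} (hW : IsIrreducibleClosed ℂ W)
    (hne : (W ∩ torusLocus ℂ (2 + 1)).Nonempty)
    (hadd : IsAddFree ℂ (2 + 1) (W ∩ torusLocus ℂ (2 + 1)))
    (hper : IsPeriodVec ℂ (projAdd '' (W ∩ torusLocus ℂ (2 + 1))) (Pi.single (Fin.last 2) 1))
    {ν : Fin (2 + 1) → ℤ} (hν : ν 0 ≠ 0 ∨ ν 1 ≠ 0)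
    (hνper : IsPeriodVec ℂ (projAdd '' (W ∩ torusLocus ℂ (2 + 1))) ν) :
    HasDominantAddProjection ℂ (W ∩ torusLocus ℂ (2 + 1)) := by
  classical
  intro p hp
  set V := W ∩ torusLocus ℂ (2 + 1) with hV
  set B := zeroLocus ℂ (vanishingIdeal ℂ (projAdd '' V)) with hB
  -- `p` vanishes on the closure `B` of `π(V)`
  have hpI : p ∈ vanishingIdeal ℂ (projAdd '' V) := by
    rw [mem_vanishingIdeal_iff]
    rintro _ ⟨z, hz, rfl⟩
    exact hp z hz
  have hpB : ∀ y ∈ B, eval y p = 0 := fun y hy => (mem_zeroLocus_iff.1 hy) p hpI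
  -- `B` is stable under `ℂ ν` and under changing the last coordinate
  have hBν : ∀ y ∈ B, ∀ t : ℂ, (y + t • fun i => (ν i : ℂ)) ∈ B := fun y hy t =>
    (isPeriodVec_iff_line _ ν).1 hνper t y hy
  have hBe : ∀ y ∈ B, ∀ s : ℂ, Function.update y (Fin.last 2) s ∈ B := fun y hy s =>
    (mem_zeroLocus_vanishingIdeal_update_last_iff hper y s).2 hy
  have hπB : ∀ z ∈ V, projAdd z ∈ B := fun z hz =>
    mem_zeroLocus_iff.2 fun q hq => (mem_vanishingIdeal_iff.1 hq) _ ⟨z, hz, rfl⟩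
  -- `N = ν₀² + ν₁² ≠ 0`
  have hNC : ((ν 0 : ℂ) ^ 2 + (ν 1 : ℂ) ^ 2) ≠ 0 := by
    have hN0 : (ν 0 ^ 2 + ν 1 ^ 2 : ℤ) ≠ 0 := by
      intro h0
      rcases hν with h | h
      · exact h (pow_eq_zero_iff two_ne_zero |>.1 (by nlinarith [sq_nonneg (ν 0), sq_nonneg (ν 1)]))
      · exact h (pow_eq_zero_iff two_ne_zero |>.1 (by nlinarith [sq_nonneg (ν 0), sq_nonneg (ν 1)]))
    have : ((ν 0 ^ 2 + ν 1 ^ 2 : ℤ) : ℂ) ≠ 0 := by exact_mod_cast hN0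
    push_cast at this
    exact this
  -- the integer direction `m = (ν₁, -ν₀, 0)` along which `ℓ = ν₁ x₀ - ν₀ x₁` has slope `N`
  have hm : (![ν 1, -ν 0, 0] : Fin (2 + 1) → ℤ) ≠ 0 := by
    intro h
    have h0 := congr_fun h 0
    have h1 := congr_fun h 1
    simp only [Matrix.cons_val_zero, Matrix.cons_val_one, Pi.zero_apply, neg_eq_zero] at h0 h1
    rcases hν with h | h
    · exact h h1
    · exact h h0
  -- (K) a point whose `ℓ`-value is the `ℓ`-value of a point of `π(V)` lies in `B`
  have key : ∀ y : Fin (2 + 1) → ℂ, ∀ z ∈ V,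
      (ν 1 : ℂ) * y 0 - (ν 0 : ℂ) * y 1 = (ν 1 : ℂ) * projAdd z 0 - (ν 0 : ℂ) * projAdd z 1 →
      y ∈ B := by
    intro y z hz hyz
    set b := projAdd z with hb
    set t : ℂ := ((ν 0 : ℂ) * (y 0 - b 0) + (ν 1 : ℂ) * (y 1 - b 1)) /
      ((ν 0 : ℂ) ^ 2 + (ν 1 : ℂ) ^ 2) with ht
    have hyz' : (ν 1 : ℂ) * (y 0 - b 0) - (ν 0 : ℂ) * (y 1 - b 1) = 0 := by
      linear_combination hyz
    have h1 := hBν b (hπB z hz) t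
    have h2 := hBe _ h1 (y (Fin.last 2))
    have hy0 : b 0 + t * (ν 0 : ℂ) = y 0 := by
      have : b 0 + t * (ν 0 : ℂ) =
          y 0 + -(ν 1 : ℂ) * ((ν 1 : ℂ) * (y 0 - b 0) - (ν 0 : ℂ) * (y 1 - b 1)) /
            ((ν 0 : ℂ) ^ 2 + (ν 1 : ℂ) ^ 2) := by
        rw [ht]
        field_simp
        ring
      rw [this, hyz', mul_zero, zero_div, add_zero]
    have hy1 : b 1 + t * (ν 1 : ℂ) = y 1 := by
      have : b 1 + t * (ν 1 : ℂ) =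
          y 1 + (ν 0 : ℂ) * ((ν 1 : ℂ) * (y 0 - b 0) - (ν 0 : ℂ) * (y 1 - b 1)) /
            ((ν 0 : ℂ) ^ 2 + (ν 1 : ℂ) ^ 2) := by
        rw [ht]
        field_simp
        ring
      rw [this, hyz', mul_zero, zero_div, add_zero]
    convert h2 using 1
    funext j
    fin_cases j
    · change y 0 = Function.update (b + t • fun i => (ν i : ℂ)) (Fin.last 2) (y (Fin.last 2)) 0
      rw [Function.update_of_ne (by decide), Pi.add_apply, Pi.smul_apply, smul_eq_mul, hy0]
    · change y 1 = Function.update (b + t • fun i => (ν i : ℂ)) (Fin.last 2) (y (Fin.last 2)) 1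
      rw [Function.update_of_ne (by decide), Pi.add_apply, Pi.smul_apply, smul_eq_mul, hy1]
    · change y 2 = Function.update (b + t • fun i => (ν i : ℂ)) (Fin.last 2) (y (Fin.last 2)) 2
      rw [show (2 : Fin (2 + 1)) = Fin.last 2 from rfl, Function.update_self]
  -- the values of `ℓ` on `π(V)` form an infinite set
  have hA : ((fun z : Fin (2 + 1) ⊕ Fin (2 + 1) → ℂ =>
      (ν 1 : ℂ) * z (Sum.inl 0) - (ν 0 : ℂ) * z (Sum.inl 1)) '' V).Infinite := by
    have h := infinite_image_linForm_of_isAddFree hW hne hadd hm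
    have hfun : (fun z : Fin (2 + 1) ⊕ Fin (2 + 1) → ℂ =>
        ∑ i, (((![ν 1, -ν 0, 0] : Fin (2 + 1) → ℤ) i : ℤ) : ℂ) * z (Sum.inl i)) =
        fun z => (ν 1 : ℂ) * z (Sum.inl 0) - (ν 0 : ℂ) * z (Sum.inl 1) := by
      funext z
      simp only [Fin.sum_univ_succ, Fin.sum_univ_zero, Matrix.cons_val_zero, Matrix.cons_val_succ,
        Fin.succ_zero_eq_one, Fin.succ_one_eq_two]
      push_cast
      ring
    rwa [hfun] at h
  -- conclude: `p` vanishes on every line `x + ℂ m`, hence everywhere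
  refine MvPolynomial.funext fun x => ?_
  rw [map_zero]
  set Q : Polynomial ℂ := (lineSubst (![ν 1, -ν 0, 0] : Fin (2 + 1) → ℤ) p).map (eval x) with hQ
  set c : ℂ := (ν 1 : ℂ) * x 0 - (ν 0 : ℂ) * x 1 with hc
  have hroot : ∀ z ∈ V, Q.IsRoot
      (((ν 1 : ℂ) * z (Sum.inl 0) - (ν 0 : ℂ) * z (Sum.inl 1) - c) /
        ((ν 0 : ℂ) ^ 2 + (ν 1 : ℂ) ^ 2)) := by
    intro z hz
    rw [Polynomial.IsRoot.def, hQ, eval_map_lineSubst]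
    refine hpB _ (key _ z hz ?_)
    simp only [Pi.add_apply, Pi.smul_apply, smul_eq_mul, Matrix.cons_val_zero, Matrix.cons_val_one,
      projAdd_apply, hc]
    push_cast
    field_simp
    ring
  have hQ0 : Q = 0 := by
    refine Polynomial.eq_zero_of_infinite_isRoot Q ?_
    refine (hA.image (f := fun a => (a - c) / ((ν 0 : ℂ) ^ 2 + (ν 1 : ℂ) ^ 2)) ?_).mono ?_
    · intro a _ a' _ haa'
      have := congrArg (fun r => r * ((ν 0 : ℂ) ^ 2 + (ν 1 : ℂ) ^ 2) + c) haa'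
      simpa [div_mul_cancel₀ _ hNC] using this
    · rintro _ ⟨_, ⟨z, hz, rfl⟩, rfl⟩
      exact hroot z hz
  have := eval_map_lineSubst (![ν 1, -ν 0, 0] : Fin (2 + 1) → ℤ) p x 0
  rw [← hQ, hQ0, Polynomial.eval_zero, zero_smul, add_zero] at this
  exact this.symm

/-- **Theorem C (normalised periodic half of `EC(3,2)`).** Let `W ⊆ ℂ³ × ℂ³` be irreducible closed,
`V = W ∩ G³` additively free with `dim cl π(V) = 2`, base period `e_last`, and `V` torus-ruled in a
direction `ν` NOT parallel to `e_last` (`(ν₀, ν₁) ≠ 0`). Then `W` meets the graph of `exp`: if `ν`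
is not a period vector of the base this is Theorem B; if it is, the additive projection is dominant
(`hasDominantAddProjection_of_isPeriodVec_of_isPeriodVec_last`) and Aslanyan–Kirby–Mantova
Thm. 1.5 applies directly.  This extends the side-cylinder theorem of `EACPeriodicCylinders`
(`ν = eᵢ`, `i ≠ last`) to arbitrary ruling directions. [cite: AslanyanKirbyMantova2021, Thm. 1.5] -/
theorem inter_expGraph_nonempty_of_isTorusStable_of_isPeriodVec_last
    {W : Set (Fin (2 + 1) ⊕ Fin (2 + 1) → ℂ)} (hW : IsIrreducibleClosed ℂ W)
    (hadd : IsAddFree ℂ (2 + 1) (W ∩ torusLocus ℂ (2 + 1))) (hbase : addProjDim ℂ (2 + 1) W = 2)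
    (hper : IsPeriodVec ℂ (projAdd '' (W ∩ torusLocus ℂ (2 + 1))) (Pi.single (Fin.last 2) 1))
    {ν : Fin (2 + 1) → ℤ} (hν : ν 0 ≠ 0 ∨ ν 1 ≠ 0)
    (hst : IsTorusStable ν (W ∩ torusLocus ℂ (2 + 1))) :
    (W ∩ expGraph ℂ (2 + 1)).Nonempty := by
  have hne := inter_torusLocus_nonempty_of_addProjDim_eq hbase
  have hν0 : ν ≠ 0 := by
    rintro rfl
    simp at hν
  by_cases hνper : IsPeriodVec ℂ (projAdd '' (W ∩ torusLocus ℂ (2 + 1))) ν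
  · exact aslanyanKirbyMantova2023_thm_1_5_holds _ W hW.1
      (hasDominantAddProjection_of_isPeriodVec_of_isPeriodVec_last hW hne hadd hper hν hνper)
  · exact inter_expGraph_nonempty_of_isTorusStable_of_not_isPeriodVec (d := 2) hW hadd hbase hν0 hst
      hνper

/-- **Theorem C′ (periodic half of `EC(3,2)`, coordinate-free form).**  Let `W ⊆ ℂ³ × ℂ³` be
irreducible closed, `V = W ∩ G³` additively free with `dim cl π(V) = 2`, let `v ≠ 0` be an integer
period vector of the base, and let `V` be torus-ruled in a direction `ν` which is ℤ-linearly
INDEPENDENT of `v`. Then `W` meets the graph of `exp`: normalise the primitive part of `v` to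
`e_last` by a lattice change `Φ_U` (only irreducibility, additive freeness, `addProjDim` and the
period are transported — no rotundity or multiplicative freeness is needed) and apply Theorem C to
`W^U`, whose ruling direction `U ν` is not parallel to `e_last`.
[cite: AslanyanKirbyMantova2021, Thm. 1.5] -/
theorem inter_expGraph_nonempty_of_isTorusStable_of_indep_period
    {W : Set (Fin (2 + 1) ⊕ Fin (2 + 1) → ℂ)} (hW : IsIrreducibleClosed ℂ W)
    (hadd : IsAddFree ℂ (2 + 1) (W ∩ torusLocus ℂ (2 + 1))) (hbase : addProjDim ℂ (2 + 1) W = 2)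
    {v : Fin (2 + 1) → ℤ} (hv0 : v ≠ 0)
    (hv : IsPeriodVec ℂ (projAdd '' (W ∩ torusLocus ℂ (2 + 1))) v)
    {ν : Fin (2 + 1) → ℤ} (hst : IsTorusStable ν (W ∩ torusLocus ℂ (2 + 1)))
    (hind : ∀ a b : ℤ, a • ν = b • v → a = 0 ∧ b = 0) :
    (W ∩ expGraph ℂ (2 + 1)).Nonempty := by
  classical
  have hne := inter_torusLocus_nonempty_of_addProjDim_eq hbase
  obtain ⟨g, v', hg, rfl, hv'⟩ := exists_eq_smul_primitive hv0
  have hv'per : IsPeriodVec ℂ (projAdd '' (W ∩ torusLocus ℂ (2 + 1))) v' :=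
    IsPeriodVec.of_zsmul hg hv
  obtain ⟨U, V, hUV, hVU, hUv', -⟩ := exists_unimodular_pair_of_primitive hv' (Fin.last 2)
  have hW' := isIrreducibleClosed_latticeClosure U hW hne
  have hT : latticeClosure U W ∩ torusLocus ℂ (2 + 1) = latticeImage U W :=
    latticeClosure_inter_torusLocus hUV hVU hW.1
  have hadd' : IsAddFree ℂ (2 + 1) (latticeClosure U W ∩ torusLocus ℂ (2 + 1)) := by
    rw [hT]
    exact isAddFree_latticeImage hUV hadd
  have hbase' : addProjDim ℂ (2 + 1) (latticeClosure U W) = 2 := by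
    have : addProjDim ℂ (2 + 1) (latticeClosure U W) = addProjDim ℂ (2 + 1) (latticeImage U W) := by
      unfold addProjDim
      rw [hT, latticeImage_inter_torusLocus]
    rw [this, addProjDim_latticeImage hUV hVU, hbase]
  have hper' : IsPeriodVec ℂ (projAdd '' (latticeClosure U W ∩ torusLocus ℂ (2 + 1)))
      (Pi.single (Fin.last 2) 1) := by
    rw [projAdd_image_latticeClosure_inter hUV hVU hW.1, ← hUv']
    exact isPeriodVec_image_intLinMap hUV hVU hv'per
  have hst' : IsTorusStable (U *ᵥ ν) (latticeClosure U W ∩ torusLocus ℂ (2 + 1)) := by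
    rw [hT]
    exact isTorusStable_latticeImage U hst
  -- `U ν` is not parallel to `e_last = U v'`, by the independence of `ν` and `v`
  have hpar : (U *ᵥ ν) 0 ≠ 0 ∨ (U *ᵥ ν) 1 ≠ 0 := by
    by_contra h
    push Not at h
    set k : ℤ := (U *ᵥ ν) (Fin.last 2) with hk
    have hUν : U *ᵥ ν = k • (U *ᵥ v') := by
      rw [hUv']
      funext j
      fin_cases j
      · simpa using h.1
      · simpa using h.2
      · simp [hk]
    have hν : ν = k • v' := by
      have h1 : V *ᵥ (U *ᵥ ν) = V *ᵥ (k • (U *ᵥ v')) := by rw [hUν]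
      rwa [Matrix.mulVec_smul, Matrix.mulVec_mulVec, Matrix.mulVec_mulVec, hVU, Matrix.one_mulVec,
        Matrix.one_mulVec] at h1
    have hdep : g • ν = k • (g • v') := by rw [hν, smul_smul, smul_smul, mul_comm]
    exact hg (hind g k hdep).1
  have h := inter_expGraph_nonempty_of_isTorusStable_of_isPeriodVec_last hW' hadd' hbase' hper' hpar
    hst'
  rwa [latticeClosure_inter_expGraph hUV hVU hW.1, latticeImage_inter_expGraph_nonempty_iff hVU] at h

/-! ## All of `EC(3,2)` for torus-ruled varieties, modulo the last-coordinate cylinder piece -/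

/-- **Torus-ruled members of `EC(3,2)`: reduction to the last-coordinate cylinder piece.**  Suppose
the following piece of the normalised periodic sub-cell is known: every `W` with the binders of
`ECCellPeriodicStd 2` (base period `e_last`) which is moreover a CYLINDER in `y_last` meets `Γ_exp`
(this piece contains Mantova–Masser's density question for exponential points of `(2,1)`-surfaces
over curve bases and is OPEN).  Then EVERY member of the cell `EC(3,2)` whose torus part is stable
under some one-parameter subtorus `y ↦ y · t^ν` meets `Γ_exp`: aperiodic base — Theorem B;
periodic base — normalise the period to `e_last` by `Φ_U` (`cell_hypotheses_latticeClosure`), then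
either `U ν ∦ e_last` (Theorem C) or `U ν = k e_last` and `W^U` is a cylinder in `y_last`
(`isCoordCylinder_zeroLocus_vanishingIdeal_of_scale`). [cite: AslanyanKirbyMantova2021, Thm. 1.5] -/
theorem inter_expGraph_nonempty_of_isTorusStable_three_two
    (hres : ∀ (W : Set (Fin (2 + 1) ⊕ Fin (2 + 1) → ℂ)), IsIrreducibleClosed ℂ W →
      (W ∩ torusLocus ℂ (2 + 1)).Nonempty → IsRotund ℂ (2 + 1) (W ∩ torusLocus ℂ (2 + 1)) →
      IsAddFree ℂ (2 + 1) (W ∩ torusLocus ℂ (2 + 1)) →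
      IsMulFree ℂ (2 + 1) (W ∩ torusLocus ℂ (2 + 1)) →
      zariskiDim ℂ W = (2 + 1 : ℕ) → addProjDim ℂ (2 + 1) W = 2 →
      IsPeriodVec ℂ (projAdd '' (W ∩ torusLocus ℂ (2 + 1))) (Pi.single (Fin.last 2) 1) →
      IsCoordCylinder W (Sum.inr (Fin.last 2)) → (W ∩ expGraph ℂ (2 + 1)).Nonempty)
    {W : Set (Fin (2 + 1) ⊕ Fin (2 + 1) → ℂ)} (hW : IsIrreducibleClosed ℂ W)
    (hne : (W ∩ torusLocus ℂ (2 + 1)).Nonempty) (hrot : IsRotund ℂ (2 + 1) (W ∩ torusLocus ℂ (2 + 1)))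
    (hadd : IsAddFree ℂ (2 + 1) (W ∩ torusLocus ℂ (2 + 1)))
    (hmul : IsMulFree ℂ (2 + 1) (W ∩ torusLocus ℂ (2 + 1))) (hdim : zariskiDim ℂ W = (2 + 1 : ℕ))
    (hbase : addProjDim ℂ (2 + 1) W = 2) {ν : Fin (2 + 1) → ℤ} (hν : ν ≠ 0)
    (hst : IsTorusStable ν (W ∩ torusLocus ℂ (2 + 1))) :
    (W ∩ expGraph ℂ (2 + 1)).Nonempty := by
  classical
  by_cases haper : HasIntegerPeriod ℂ (projAdd '' (W ∩ torusLocus ℂ (2 + 1)))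
  swap
  · exact inter_expGraph_nonempty_of_isTorusStable_of_not_hasIntegerPeriod hW hadd hbase hν hst haper
  -- periodic base: normalise the period to `e_last`
  obtain ⟨v, hv0, hv⟩ := haper
  obtain ⟨g, v', hg, rfl, hv'⟩ := exists_eq_smul_primitive hv0
  have hv'per : IsPeriodVec ℂ (projAdd '' (W ∩ torusLocus ℂ (2 + 1))) v' :=
    IsPeriodVec.of_zsmul hg hv
  obtain ⟨U, V, hUV, hVU, hUv', -⟩ := exists_unimodular_pair_of_primitive hv' (Fin.last 2)
  obtain ⟨hW', hne', hrot', hadd', hmul', hdim', hbase', hiff⟩ :=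
    cell_hypotheses_latticeClosure (d := 2) hUV hVU hW hne hrot hadd hmul hdim hbase
  have hT : latticeClosure U W ∩ torusLocus ℂ (2 + 1) = latticeImage U W :=
    latticeClosure_inter_torusLocus hUV hVU hW.1
  have hper' : IsPeriodVec ℂ (projAdd '' (latticeClosure U W ∩ torusLocus ℂ (2 + 1)))
      (Pi.single (Fin.last 2) 1) := by
    rw [projAdd_image_latticeClosure_inter hUV hVU hW.1, ← hUv']
    exact isPeriodVec_image_intLinMap hUV hVU hv'per
  have hst' : IsTorusStable (U *ᵥ ν) (latticeClosure U W ∩ torusLocus ℂ (2 + 1)) := by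
    rw [hT]
    exact isTorusStable_latticeImage U hst
  refine hiff.1 ?_
  by_cases hpar : (U *ᵥ ν) 0 ≠ 0 ∨ (U *ᵥ ν) 1 ≠ 0
  · exact inter_expGraph_nonempty_of_isTorusStable_of_isPeriodVec_last hW' hadd' hbase' hper' hpar hst'
  · -- `U ν = k e_last`: `W^U` is a cylinder in `y_last`
    push Not at hpar
    set k : ℤ := (U *ᵥ ν) (Fin.last 2) with hk
    have hUν : U *ᵥ ν = Pi.single (Fin.last 2) k := by
      funext j
      fin_cases j
      · simpa using hpar.1
      · simpa using hpar.2
      · simp [hk]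
    have hk0 : k ≠ 0 := by
      intro h0
      apply mulVec_ne_zero_of_mul_eq_one hVU hν
      rw [hUν, h0, Pi.single_zero]
    have hcyl : IsCoordCylinder (latticeClosure U W) (Sum.inr (Fin.last 2)) := by
      change IsCoordCylinder (zeroLocus ℂ (vanishingIdeal ℂ (latticeImage U W))) (Sum.inr (Fin.last 2))
      refine isCoordCylinder_zeroLocus_vanishingIdeal_of_scale hk0
        (fun z hz => latticeImage_subset_torusLocus U W hz (Fin.last 2)) (fun z hz t ht => ?_)
      rw [← torusScale_single, ← hUν]
      rw [← hT] at hz ⊢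
      exact hst' z hz t ht
    exact hres _ hW' hne' hrot' hadd' hmul' hdim' hbase' hper' hcyl

end Summit.Schanuel.Schanuel.Theorems
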